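import Summits.Ventures.LatticeQCDFlow.Scaling.FlowTemperingConjugacy
import Summits.Ventures.LatticeQCDFlow.Scaling.ReplicaExchangeBareErgodic
import Literature.Probability.MarkovChains.AsymptoticVarianceSpectral

/-!
HONEST FRAMING: exact (Metropolis-corrected) sampling algorithms for lattice gauge theory; figures
of merit are autocorrelation/cost numbers at stated couplings and volumes; no continuum-physics
claim.

# FlowSamplerTauInt — THE INTEGRATED AUTOCORRELATION TIME OF EVERY OBSERVABLE UNDER THE MAP-ASSISTED SAMPLERS:
# IRREDUCIBILITY TRANSFERS THROUGH LEVEL COORDINATES (THE HOT UPDATE ALONE SUFFICES), SO THE FLOORS OF CHAPTER I GIVE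
# `τ_int(g) ≤ 1/c − ½` FOR EVERY NON-CONSTANT `g` — PERFECT ADJACENT TRANSPORTS: `c = min{t/(6K²(K+1)), γ₀(1−t)/(6(K+1)²)}`
# (LADDER), `c = min{1/K,γ₀}/(25(K+1))` (TEMPERING) (lean-2 GEN-21, ours)

Venture-side (OURS).  Cell `lqcd-flow` (pub-lqcd), unit `pub-lqcd-lean-2-g21`, 2026-08-26.  Chapter I, ninth file: the
`τ_int` currency (`τ_int(g) = asympVar(g)/(2Var(g))`, one step = one swap/transport attempt or one replica / within-level
update) for the relaxation guarantees of `Scaling/FlowLadderConjugacy` (I3) and `Scaling/FlowTemperingConjugacy` (I4)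
(the sector-preserving floors of `Scaling/FlowLadderModeGap` get theirs in `Scaling/FlowLadderModeGapHeating`), through the Literature's `asympVar_le_spectralGap`
(`asympVar(g) ≤ (2/Gap − 1)·Var(g)` for an irreducible reversible chain).  The one new ingredient is IRREDUCIBILITY of the
map-assisted samplers: matrix powers relabel (`pow_relabel_apply`), so irreducibility is invariant under the level
coordinates (`isIrreducible_relabel`), and in level coordinates the samplers are the plain ones, irreducible as soon as the
HOT update is (`Scaling/ReplicaExchangeBareErgodic`, `Scaling/SimulatedTemperingFrozenCold`) — the cold updates and the
maps arbitrary.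

## What is proved

* §1 `submatrix_pow_equiv` (`(P∘e)^n = (P^n)∘e`), **`isIrreducible_relabel`**;
  **`ptFlowSampler_isIrreducible_of_hot`**, **`stFlowSampler_isIrreducible_of_hot`** (hot update irreducible, `0 < t < 1`
  ⇒ the map-assisted ladder / tempering sampler is irreducible, for EVERY family of bijections and cold updates).
* §2 `tauInt_le_of_gapFloor` (generic: `Gap ≥ c > 0`, irreducible reversible ⇒ `asympVar(g)/(2Var(g)) ≤ 1/c − ½`);
  **`flowLadderPerfect_tauInt_le`** (`μ_{j+1}∘φ_j = μ_j`: `τ_int(g) ≤ 1/min{t/(6K²(K+1)), γ₀(1−t)/(6(K+1)²)} − ½`);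
  **`flowTemperingPerfect_tauInt_le`** (`τ_int(g) ≤ 25(K+1)/min{1/K, γ₀} − ½`).

Reading (no numerics implied): for every observable of the replica configurations, an exact flow ladder whose maps
transport each level onto the next decorrelates within order `K³` steps with constants from the hot replica alone.
NOT CLAIMED: the hub (its irreducibility lemma is not in the tree); anything measured.  Literature grade (cell rule): OWN
COROLLARIES + one generic relabelling lemma; nothing cited as a fact; no new bib keys.
-/

noncomputable section

open Finset Function
open Literature.Probability.MarkovChains

namespace Summit.Ventures.LatticeQCDFlow.Scaling

/-! ## §1 Irreducibility in level coordinates -/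

section Irreducible

variable {X Y : Type*} [Fintype X] [Fintype Y] [DecidableEq X] [DecidableEq Y]

/-- **Matrix powers relabel:** `(P∘e)^n = (P^n)∘e` (as submatrices along a bijection `e : X ≃ Y`). [ours] -/
theorem submatrix_pow_equiv (e : X ≃ Y) (P : Matrix Y Y ℝ) (n : ℕ) :
    (P.submatrix e e) ^ n = (P ^ n).submatrix e e := by
  induction n with
  | zero => rw [pow_zero, pow_zero, Matrix.submatrix_one_equiv]
  | succ n ih => rw [pow_succ, pow_succ, ih, Matrix.submatrix_mul_equiv]

/-- **Irreducibility is invariant under relabelling:** `P` irreducible ⇒ `P∘e` irreducible. [ours] -/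
theorem isIrreducible_relabel (e : X ≃ Y) {P : Matrix Y Y ℝ} (hP : IsIrreducible P) :
    IsIrreducible (fun a b => P (e a) (e b) : Matrix X X ℝ) := by
  show IsIrreducible (P.submatrix e e)
  intro x y
  obtain ⟨n, hn⟩ := hP (e x) (e y)
  exact ⟨n, by rw [submatrix_pow_equiv, Matrix.submatrix_apply]; exact hn⟩

end Irreducible

variable {S : Type*} [Fintype S] [DecidableEq S] {K : ℕ} {μ : Fin (K + 1) → S → ℝ} {t : ℝ}

/-- **The flow ladder is irreducible as soon as the HOT update is** — for every family of bijections `φ` and arbitrary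
cold updates (`0 < t < 1`, positive level laws). [ours] -/
theorem ptFlowSampler_isIrreducible_of_hot {M : Fin (K + 1) → S → S → ℝ} (φ : Fin K → Equiv.Perm S)
    (hμ : ∀ k x, 0 < μ k x) (hM : ∀ k, IsRowStochastic (M k)) (hM0 : IsIrreducible (M 0)) (ht0 : 0 < t) (ht1 : t < 1) :
    IsIrreducible (ptFlowSampler t μ M φ) := by
  obtain ⟨L, hL0, hLφ⟩ := exists_levelMaps φ
  have hφ : φ = fun j : Fin K => (L j.castSucc).trans (L j.succ).symm := (funext hLφ).symm
  subst hφ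
  have hL0u : ∀ u, (L 0).symm u = u := fun u => by rw [hL0]; rfl
  have hM0' : (fun u v => M 0 ((L 0).symm u) ((L 0).symm v)) = M 0 := funext fun u => funext fun v => by rw [hL0u, hL0u]
  -- the conjugate plain ladder is irreducible from its hot update `M^L_0 = M_0`
  have hirr : IsIrreducible (ptBareSampler t (fun i u => μ i ((L i).symm u))
      (fun i u v => M i ((L i).symm u) ((L i).symm v))) := by
    refine ptBareSampler_isIrreducible_of_hot (fun k u => hμ k _)
      (fun k => ⟨fun u v => (hM k).1 _ _,
        fun u => by simpa using (Equiv.sum_comp (L k).symm (fun v => M k ((L k).symm u) v)).trans ((hM k).2 _)⟩) ?_ ht0 ht1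
    show IsIrreducible (fun u v => M 0 ((L 0).symm u) ((L 0).symm v))
    rw [hM0']; exact hM0
  have h := isIrreducible_relabel (Equiv.piCongrRight L) hirr
  have e : (fun a b : Fin (K + 1) → S => ptBareSampler t (fun i u => μ i ((L i).symm u))
      (fun i u v => M i ((L i).symm u) ((L i).symm v)) (Equiv.piCongrRight L a) (Equiv.piCongrRight L b))
      = ptFlowSampler t μ M (fun j : Fin K => (L j.castSucc).trans (L j.succ).symm) := by
    funext a b; exact (ptFlowSampler_eq_conj L t μ M a b).symm
  rw [e] at h
  exact h

/-- **The tempering sampler with transport maps is irreducible as soon as the HOT update is** (every family of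
bijections, arbitrary within-level updates elsewhere; `0 < t < 1`). [ours] -/
theorem stFlowSampler_isIrreducible_of_hot {M : Fin (K + 1) → Matrix S S ℝ} (φ : Fin K → Equiv.Perm S)
    (hμ : ∀ k x, 0 < μ k x) (hM : ∀ k, IsRowStochastic (M k)) (hM0 : IsIrreducible (M 0)) (ht0 : 0 < t) (ht1 : t < 1) :
    IsIrreducible (stFlowSampler t μ M φ) := by
  obtain ⟨L, hL0, hLφ⟩ := exists_levelMaps φ
  have hφ : φ = fun j : Fin K => (L j.castSucc).trans (L j.succ).symm := (funext hLφ).symm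
  subst hφ
  have hL0u : ∀ u, (L 0).symm u = u := fun u => by rw [hL0]; rfl
  have hM0' : (Matrix.of fun u v => M 0 ((L 0).symm u) ((L 0).symm v)) = M 0 := by
    ext u v; rw [Matrix.of_apply, hL0u, hL0u]
  have hirr : IsIrreducible (stFinSampler t (fun i u => μ i ((L i).symm u))
      (fun i => Matrix.of fun u v => M i ((L i).symm u) ((L i).symm v))) := by
    refine stFinSampler_isIrreducible_of_hot (fun k u => hμ k _)
      (fun k => ⟨fun u v => (hM k).1 _ _,
        fun u => by simpa using (Equiv.sum_comp (L k).symm (fun v => M k ((L k).symm u) v)).trans ((hM k).2 _)⟩) ?_ ht0 ht1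
    show IsIrreducible (Matrix.of fun u v => M 0 ((L 0).symm u) ((L 0).symm v))
    rw [hM0']; exact hM0
  have h := isIrreducible_relabel (Equiv.prodCongrRight L) hirr
  have e : (fun a b : Fin (K + 1) × S => stFinSampler t (fun i u => μ i ((L i).symm u))
      (fun i => Matrix.of fun u v => M i ((L i).symm u) ((L i).symm v)) (Equiv.prodCongrRight L a) (Equiv.prodCongrRight L b))
      = stFlowSampler t μ M (fun j : Fin K => (L j.castSucc).trans (L j.succ).symm) := by
    funext a b
    rw [Equiv.prodCongrRight_apply, Equiv.prodCongrRight_apply]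
    exact (stFlowSampler_eq_conj L hμ t M a b).symm
  rw [e] at h
  exact h

/-! ## §2 `τ_int` ceilings for every observable -/

/-- **From a gap floor to `τ_int`:** an irreducible reversible chain with `Gap ≥ c > 0` has
`asympVar(g)/(2Var(g)) ≤ 1/c − ½` for every non-constant `g`. [ours] -/
theorem tauInt_le_of_gapFloor {X : Type*} [Fintype X] [DecidableEq X] [Nontrivial X] {π : X → ℝ} (hπ : ∀ x, 0 < π x)
    (hπ1 : ∑ x, π x = 1) {P : Matrix X X ℝ} (hP : IsRowStochastic P) (hDB : DetailedBalance π P) (hirr : IsIrreducible P)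
    {c : ℝ} (hc0 : 0 < c) (hc : c ≤ spectralGap π P) {g : X → ℝ} (hg : 0 < lawVariance π g) :
    asympVar g π P / (2 * lawVariance π g) ≤ 1 / c - 1 / 2 := by
  have h := asympVar_le_spectralGap hπ hπ1 hP hDB hirr g
  have h2 : 2 / spectralGap π P - 1 ≤ 2 / c - 1 := by
    have := div_le_div_of_nonneg_left (by norm_num : (0 : ℝ) ≤ 2) hc0 hc
    linarith
  have h3 : asympVar g π P ≤ (2 / c - 1) * lawVariance π g :=
    h.trans (mul_le_mul_of_nonneg_right h2 hg.le)
  rw [div_le_iff₀ (by positivity)]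
  have e : (1 / c - 1 / 2) * (2 * lawVariance π g) = (2 / c - 1) * lawVariance π g := by ring
  rw [e]; exact h3

/-- **LADDER WITH PERFECT ADJACENT TRANSPORTS, EVERY OBSERVABLE:** `μ_{j+1}(φ_j u) = μ_j(u)` for all `j`, hot update
irreducible with Poincaré constant `γ₀`, cold laws and cold updates arbitrary:
`τ_int(g) ≤ 1/min{t/(6K²(K+1)), γ₀(1−t)/(6(K+1)²)} − ½`. [ours] -/
theorem flowLadderPerfect_tauInt_le [Nontrivial S] {M : Fin (K + 1) → S → S → ℝ} (φ : Fin K → Equiv.Perm S) (hK : 1 ≤ K)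
    (hμ : ∀ k x, 0 < μ k x) (hμ1 : ∀ k, ∑ u, μ k u = 1) (hM : ∀ k, IsRowStochastic (M k))
    (hMrev : ∀ k, DetailedBalance (μ k) (M k)) (hM0 : IsIrreducible (M 0)) (ht0 : 0 < t) (ht1 : t < 1)
    (hperfect : ∀ (j : Fin K) (u : S), μ j.succ (φ j u) = μ j.castSucc u) {γ₀ : ℝ} (hγ₀ : 0 < γ₀)
    (hgap0 : ∀ h : S → ℝ, γ₀ * lawVariance (μ 0) h ≤ dirichletForm (μ 0) (M 0) h)
    {g : (Fin (K + 1) → S) → ℝ} (hg : 0 < lawVariance (tensorFun μ) g) :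
    asympVar g (tensorFun μ) (ptFlowSampler t μ M φ) / (2 * lawVariance (tensorFun μ) g)
      ≤ 1 / min (t / (6 * K ^ 2 * (K + 1))) (γ₀ * (1 - t) / (6 * (K + 1) ^ 2)) - 1 / 2 := by
  have hKpos : (0 : ℝ) < K := Nat.cast_pos.mpr (by omega)
  exact tauInt_le_of_gapFloor (tensorFun_pos hμ) (sum_tensorFun_eq_one μ hμ1)
    (ptFlowSampler_isRowStochastic hμ hM ht0.le ht1.le) (ptFlowSampler_detailedBalance hμ hMrev)
    (ptFlowSampler_isIrreducible_of_hot φ hμ hM hM0 ht0 ht1)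
    (lt_min (by positivity) (div_pos (mul_pos hγ₀ (by linarith)) (by positivity)))
    (flowLadderPerfect_spectralGap_ge_of_adjacent φ hK hμ hμ1 hM hMrev ht0 ht1 hperfect hγ₀ hgap0) hg

/-- **TEMPERING WITH PERFECT ADJACENT TRANSPORTS, EVERY OBSERVABLE** (`t = ½`): `μ_{j+1}(φ_j u) = μ_j(u)`, hot update
irreducible with Poincaré constant `γ₀`, arbitrary cold laws and within-level updates:
`τ_int(g) ≤ 25(K+1)/min{1/K, γ₀} − ½`. [ours] -/
theorem flowTemperingPerfect_tauInt_le {M : Fin (K + 1) → Matrix S S ℝ} (φ : Fin K → Equiv.Perm S) (hK : 1 ≤ K)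
    (hμ : ∀ k x, 0 < μ k x) (hμ1 : ∀ k, ∑ x, μ k x = 1) (hM : ∀ k, IsRowStochastic (M k))
    (hMrev : ∀ k, DetailedBalance (μ k) (M k)) (hM0 : IsIrreducible (M 0))
    (hperfect : ∀ (j : Fin K) (u : S), μ j.succ (φ j u) = μ j.castSucc u) {γ₀ : ℝ} (hγ₀ : 0 < γ₀)
    (hgap0 : ∀ h : S → ℝ, γ₀ * lawVariance (μ 0) h ≤ dirichletForm (μ 0) (M 0) h)
    {g : Fin (K + 1) × S → ℝ} (hg : 0 < lawVariance (stFinLaw μ) g) :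
    asympVar g (stFinLaw μ) (stFlowSampler (1 / 2) μ M φ) / (2 * lawVariance (stFinLaw μ) g)
      ≤ 25 * (K + 1) / min (1 / (K : ℝ)) γ₀ - 1 / 2 := by
  haveI : Nonempty S := by
    by_contra h
    rw [not_nonempty_iff] at h
    have := hμ1 0
    rw [Finset.univ_eq_empty, Finset.sum_empty] at this
    exact zero_ne_one this
  haveI : Nontrivial (Fin (K + 1)) := Fin.nontrivial_iff_two_le.mpr (by omega)
  have ht0 : (0 : ℝ) < 1 / 2 := by norm_num
  have ht1 : (1 / 2 : ℝ) < 1 := by norm_num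
  have hKpos : (0 : ℝ) < K := Nat.cast_pos.mpr (by omega)
  have hc0 : 0 < min (1 / (K : ℝ)) γ₀ / (25 * (K + 1)) := div_pos (lt_min (by positivity) hγ₀) (by positivity)
  have h := tauInt_le_of_gapFloor (stFinLaw_pos hμ) (sum_stFinLaw hμ1)
    (stFlowSampler_isRowStochastic hμ hM ht0.le ht1.le) (stFlowSampler_detailedBalance hμ hMrev)
    (stFlowSampler_isIrreducible_of_hot φ hμ hM hM0 ht0 ht1) hc0
    (flowTemperingPerfect_spectralGap_ge_of_adjacent φ hK hμ hμ1 hM hMrev hperfect hγ₀ hgap0) hg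
  have e : 1 / (min (1 / (K : ℝ)) γ₀ / (25 * (K + 1))) = 25 * (K + 1) / min (1 / (K : ℝ)) γ₀ := by
    rw [one_div, inv_div]
  rw [e] at h
  exact h

end Summit.Ventures.LatticeQCDFlow.Scaling

end
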